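import Literature.RingTheory.LocalCohomology.CechFormalSections
import Literature.RingTheory.LocalCohomology.CechH2BaseChange
import Literature.RingTheory.RegularLocalRing.SamuelEndgame
import Literature.RingTheory.RegularLocalRing.HypersurfaceDepth
import Literature.RingTheory.RegularLocalRing.GrothendieckSamuelHypersurfaceComplete
import Mathlib.RingTheory.Regular.RegularSequence
import Mathlib.RingTheory.KrullDimension.Zero
import HarnessLib

/-!
# Grothendieck's theorem on Samuel's conjecture for hypersurfaces — the proof

Topic `Literature/RingTheory/RegularLocalRing`. This file DISCHARGES the named fact
`Literature.RingTheory.RegularLocalRing.Grothendieck1968_samuelConjecture_hypersurface`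
(SGA 2 XI Cor. 3.14 for hypersurface rings `R/(f)`, `R` regular local: factorial in codimension
`≤ 3` ⇒ factorial) by proving `Grothendieck1968_samuelConjecture_hypersurface_holds`.

Architecture of the printed proof (SGA 2 XI 3.14 ⇐ 3.10 ⇐ 3.13 (ii) ⇐ 3.7; Call–Lyubeznik 1994
give a simplified account of the same chain) as formalised in this tree:

* `GrothendieckSamuelHypersurfaceProofs.lean` — the outer induction of Cor. 3.14 (small
  dimensions are hypotheses; large dimension ⇒ parafactoriality suffices) and XI 3.10 for
  hypersurface rings (`…_of_kernel`, `…_of_parafactorial`);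
* `GrothendieckSamuelHypersurfaceComplete.lean` — XI 3.7: reduction to the completion by
  faithfully flat descent (`…_of_complete`), and the cover data of an ideal principal on the
  punctured spectrum;
* `Literature/RingTheory/LocalCohomology/Cech*.lean` — the Čech complex of a module, its
  torsion, the vanishing of local cohomology below the depth (`cech_exact_of_isRegular`, the
  depth input of XI 3.16/3.17), the finiteness of `H²_𝔪(J)` (`CechFiniteness`, SGA 2 VIII 2.3 in
  the needed case), twisted cochains and the lifting of unit cocycles (`CechTwisted`, XI 3.16:
  `Pic(U_{k+1}) → Pic(U_k)` onto when `H³_𝔪 = 0`), the formal line bundle, uniform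
  Mittag-Leffler and the limit module of stable sections (`CechFormalSections`, IX §1–2);
* `SamuelEndgame.lean` (with `AdicGeneration`, `RankOneEmbedding`, `SaturationPrincipal`) — the
  algebraisation of the module of formal sections and the conclusion (IX §2, XI 3.5/3.9/3.13).

Here (`samuel_hypersurface_complete_thick`, `samuel_hypersurface_complete`) the pieces are
assembled for a complete regular local `S`, `0 ≠ g ∈ 𝔪`, `dim S/(g) ≥ 4` and an ideal
`J ⊆ S/(g)` with a non-zero-divisor, principal at the non-maximal primes and `𝔪`-saturated:
`S/(g)` is Cohen–Macaulay of dimension `≥ 4` (`HypersurfaceDepth`), so its Čech complex with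
respect to a cover `(g, ỹ)` adapted to `J` is exact in degrees `≤ 3`; the transition cocycle
`ā_j/ā_i` of `J` lifts to all thickenings; `E = H²` of the twisted complex is Noetherian
(`≅` a submodule of `H²_𝔪(J)`, finite by `CechFiniteness` + base change); uniform
Mittag-Leffler gives the limit module `N` with its comparison map `N → J`, and
`isPrincipal_of_comparison` yields `J` principal. Hence `hC`, hence the fact.

Everything is proved; no named facts are introduced.

## References

* [Grothendieck1968SGA2] A. Grothendieck, SGA 2, Exp. XI, Thm. 3.13 (ii), Cor. 3.14, Lemme 3.16,
  Prop. 3.5, Cor. 3.9, Cor. 3.7, Prop. 3.10; Exp. IX §1–2; Exp. VIII Thm. 2.3; Exp. III 3.1–3.3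
  (arXiv:math/0511279, pp. 17, 55–58, 70–72).
* [CallLyubeznik1994] F. Call, G. Lyubeznik, *A simple proof of Grothendieck's theorem on the
  parafactoriality of local rings*, Contemp. Math. 159 (1994), 15–18.
* [Matsumura1987] H. Matsumura, *Commutative Ring Theory*, Thm. 16.7, 17.4, 20.3.
-/

noncomputable section

open CategoryTheory AlgebraicTopology

universe u v

namespace Literature.RingTheory.RegularLocalRing

open Literature.RingTheory.LocalCohomology

section H2Torsion

variable {R : Type u} [CommRing R] {s : ℕ} {y : Fin s → R} {M : Type u} [AddCommGroup M]
  [Module R M]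

/-- Every class of `H²(y; M)` is killed by a power of each `y_j`. [folklore] -/
theorem exists_pow_smul_H2_eq_zero (e : H2 (y := y) (M := M)) (j : Fin s) :
    ∃ K : ℕ, y j ^ K • e = 0 := by
  obtain ⟨⟨z, hz⟩, rfl⟩ := Submodule.Quotient.mk_surjective _ e
  obtain ⟨K, b, hb⟩ := exists_pow_smul_eq_dC 0 z (LinearMap.mem_ker.mp hz) j
  refine ⟨K, ?_⟩
  rw [← Submodule.Quotient.mk_smul, Submodule.Quotient.mk_eq_zero]
  simp only [Submodule.mem_comap, Submodule.coe_subtype, LinearMap.mem_range, Submodule.coe_smul]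
  exact ⟨b, hb.symm⟩

/-- A Noetherian module all of whose elements are killed by a power of each `y_j` is killed by
a power of any ideal contained in `√(y)`. [folklore] -/
theorem exists_pow_ideal_smul_eq_zero [IsNoetherianRing R] {E : Type u} [AddCommGroup E] [Module R E]
    [Module.Finite R E] (htor : ∀ (e : E) (j : Fin s), ∃ K : ℕ, y j ^ K • e = 0)
    (𝔪 : Ideal R) (h𝔪 : 𝔪 ≤ (Ideal.span (Set.range y)).radical) :
    ∃ c : ℕ, ∀ (e : E), ∀ r ∈ 𝔪 ^ c, r • e = 0 := by
  classical
  -- the annihilator contains a power of each `y_j`, hence its radical contains `𝔪`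
  obtain ⟨n, gen, hgen⟩ := Module.Finite.exists_fin (R := R) (M := E)
  have hann : ∀ j : Fin s, ∃ K : ℕ, y j ^ K ∈ Module.annihilator R E := by
    intro j
    choose K hK using fun i => htor (gen i) j
    refine ⟨Finset.univ.sup K, Module.mem_annihilator.mpr fun e => ?_⟩
    have he : e ∈ Submodule.span R (Set.range gen) := by rw [hgen]; trivial
    refine Submodule.span_induction ?_ ?_ ?_ ?_ he
    · rintro _ ⟨i, rfl⟩
      have hle : K i ≤ Finset.univ.sup K := Finset.le_sup (Finset.mem_univ i)
      obtain ⟨d, hd⟩ := Nat.exists_eq_add_of_le hle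
      rw [hd, pow_add, mul_comm, mul_smul, hK, smul_zero]
    · exact smul_zero _
    · intro a b _ _ ha hb; rw [smul_add, ha, hb, add_zero]
    · intro a b _ hb; rw [smul_comm, hb, smul_zero]
  have hrad : 𝔪 ≤ (Module.annihilator R E).radical := by
    refine h𝔪.trans ?_
    apply Ideal.radical_le_radical_iff.mpr
    rw [Ideal.span_le]
    rintro _ ⟨j, rfl⟩
    obtain ⟨K, hK⟩ := hann j
    exact ⟨K, hK⟩
  obtain ⟨c, hc⟩ := Ideal.exists_pow_le_of_le_radical_of_fg hrad (IsNoetherian.noetherian 𝔪)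
  exact ⟨c, fun e r hr => Module.mem_annihilator.mp (hc hr) e⟩

end H2Torsion

end Literature.RingTheory.RegularLocalRing

namespace Literature.RingTheory.RegularLocalRing

/-- A ring of positive Krull dimension has a non-maximal prime. [folklore] -/
theorem exists_isPrime_not_isMaximal {B : Type u} [CommRing B] (h : ¬ ringKrullDim B ≤ 0) :
    ∃ Q : Ideal B, Q.IsPrime ∧ ¬ Q.IsMaximal := by
  by_contra hcon
  push Not at hcon
  apply h
  have : Ring.KrullDimLE 0 B := Ring.krullDimLE_zero_iff.mpr fun Q hQ => hcon Q hQ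
  have := (Ring.krullDimLE_iff (R := B) (n := 0)).mp this
  exact_mod_cast this

/-- A regular sequence on `S ⧸ I` (as a ring) lifts to an `S`-regular sequence on the
`S`-module `S ⧸ I`. [folklore] -/
theorem isRegular_quotient_of_map {S : Type u} [CommRing S] (I : Ideal S) (rs : List S)
    (h : RingTheory.Sequence.IsRegular (S ⧸ I) (rs.map (Ideal.Quotient.mk I))) :
    RingTheory.Sequence.IsRegular (S ⧸ I) rs := by
  refine ⟨(RingTheory.Sequence.isWeaklyRegular_map_algebraMap_iff (S := S ⧸ I) (M := S ⧸ I) rs).mp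
    (by rw [Ideal.Quotient.algebraMap_eq]; exact h.toIsWeaklyRegular), ?_⟩
  intro htop
  apply h.top_ne_smul
  apply Submodule.restrictScalars_injective S
  rw [Submodule.restrictScalars_top, ← Ideal.map_ofList, ← Ideal.Quotient.algebraMap_eq,
    Ideal.smul_restrictScalars, Submodule.restrictScalars_top]
  exact htop

end Literature.RingTheory.RegularLocalRing

namespace Literature.RingTheory.RegularLocalRing

open IsLocalRing nonZeroDivisors Literature.RingTheory.LocalCohomology
open Literature.AlgebraicGeometry.Resolution (isLocalRing_quotient_span_singleton
  isDomain_of_isRegularLocalRing uniqueFactorizationMonoid_of_isRegularLocalRing)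

section Kernel

variable {S : Type u} [CommRing S]

/-- The augmentation is natural in the module. [folklore] -/
theorem cechObjMap_zero_cechAug {s : ℕ} (y : Fin s → S) {M' N' : Type u} [AddCommGroup M']
    [Module S M'] [AddCommGroup N'] [Module S N'] (φ : M' →ₗ[S] N') (m : M') :
    cechObjMap y φ 0 (cechAug y M' m) = cechAug y N' (φ m) := by
  funext t
  rw [cechObjMap_apply, cechAug_apply, cechAug_apply, locMap_mk]

/-- **Depth `≥ 2` of an `𝔪`-saturated ideal, in Čech terms.** If the extended Čech complex of
the local ring `B` (as a module over `S ↠ B`) is exact in degrees `0, 1` and `√(y) = 𝔪_B`, then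
so is that of every `𝔪`-saturated ideal `J`: the augmentation `J → Č⁰(J)` is injective and its
image is the module of cocycles. [folklore] -/
theorem cech_exact_ideal_of_saturated {B : Type u} [CommRing B] [Algebra S B] [IsLocalRing B]
    [IsNoetherianRing B] {s : ℕ} (y : Fin s → S)
    (hrad : (Ideal.span (Set.range fun i => algebraMap S B (y i))).radical = maximalIdeal B)
    (hB0 : ∀ b : B, cechAug y B b = 0 → b = 0)
    (hB1 : ∀ c : CechObj y B 0, dC 0 c = 0 → ∃ b : B, cechAug y B b = c)
    (J : Ideal B) (hsat : ∀ b : B, (∀ x : B, ¬ IsUnit x → x * b ∈ J) → b ∈ J) :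
    Function.Injective (cechAug y J) ∧
      ∀ c : CechObj y J 0, dC 0 c = 0 → ∃ j : J, cechAug y J j = c := by
  have hnat : ∀ j : J, cechObjMap y (J.subtype.restrictScalars S) 0 (cechAug y J j) =
      cechAug y B (j : B) := fun j => cechObjMap_zero_cechAug y _ j
  have hinjsub : Function.Injective (cechObjMap y (J.subtype.restrictScalars S) 0) :=
    cechObjMap_injective y _ Subtype.val_injective 0
  refine ⟨fun j j' h => ?_, fun c hc => ?_⟩
  · apply Subtype.ext
    have h1 : cechAug y B ((j : B) - (j' : B)) = 0 := by
      rw [map_sub, ← hnat, ← hnat, h, sub_self]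
    exact sub_eq_zero.mp (hB0 _ h1)
  · -- the cocycle of `B` underlying `c` comes from some `b ∈ B`
    have hc' : dC 0 (cechObjMap y (J.subtype.restrictScalars S) 0 c) = 0 := by
      rw [dC_cechObjMap, hc, map_zero]
    obtain ⟨b, hb⟩ := hB1 _ hc'
    -- `b ∈ J`: `y_i^N b ∈ J` for every `i`
    have hbJ : b ∈ J := by
      apply mem_of_forall_pow_mul_mem J hsat (fun i => algebraMap S B (y i)) hrad b
      intro i
      have h1 := congrFun hb ![i]
      rw [cechAug_apply, cechObjMap_apply] at h1
      -- `c ![i] = j / y_i^k`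
      generalize hci : c ![i] = ci at h1
      induction ci using LocalizedModule.induction_on with
      | h j sj =>
        obtain ⟨_, k, rfl⟩ := sj
        rw [locMap_mk, LocalizedModule.mk_eq] at h1
        obtain ⟨⟨_, m, rfl⟩, hm⟩ := h1
        rw [one_smul, Submonoid.smul_def, Submonoid.smul_def, Submonoid.smul_def] at hm
        have htp : tupleProd y ![i] = y i := by simp [tupleProd]
        change (tupleProd y ![i] ^ m) • ((tupleProd y ![i] ^ k) • b) =
          (tupleProd y ![i] ^ m) • ((j : J) : B) at hm
        rw [htp] at hm
        refine ⟨m + k, ?_⟩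
        have h2 : algebraMap S B (y i) ^ (m + k) * b = (y i ^ m) • ((y i ^ k) • b) := by
          rw [← mul_smul, ← pow_add, Algebra.smul_def, map_pow]
        rw [h2, hm, Algebra.smul_def]
        exact J.mul_mem_left _ j.2
    refine ⟨⟨b, hbJ⟩, hinjsub ?_⟩
    rw [hnat]
    exact hb

end Kernel

end Literature.RingTheory.RegularLocalRing

namespace Literature.RingTheory.RegularLocalRing

open IsLocalRing nonZeroDivisors Literature.RingTheory.LocalCohomology
open Literature.AlgebraicGeometry.Resolution (isLocalRing_quotient_span_singleton
  isDomain_of_isRegularLocalRing uniqueFactorizationMonoid_of_isRegularLocalRing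
  maximalIdeal_quotient_eq_map)

section MainKernel

/-- `√(g, ỹ) ⊇ 𝔪_S` when the images `ȳ` of the `ỹ` satisfy `√(ȳ) = 𝔪_{S/(g)}`. [folklore] -/
theorem maximalIdeal_le_radical_span_cons {S : Type u} [CommRing S] [IsLocalRing S] {g : S}
    {s : ℕ} (yt : Fin s → S) {B : Type u} [CommRing B] [Algebra S B] [IsLocalRing B]
    (hsurj : Function.Surjective (algebraMap S B))
    (hker : ∀ x : S, algebraMap S B x = 0 → x ∈ Ideal.span {g})
    (hmB : (maximalIdeal S).map (algebraMap S B) = maximalIdeal B)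
    (hrad : (Ideal.span (Set.range fun i => algebraMap S B (yt i))).radical = maximalIdeal B) :
    maximalIdeal S ≤ (Ideal.span (Set.range (Fin.cons g yt : Fin (s + 1) → S))).radical := by
  intro r hr
  have hrB : algebraMap S B r ∈ maximalIdeal B := by
    rw [← hmB]; exact Ideal.mem_map_of_mem _ hr
  rw [← hrad] at hrB
  obtain ⟨k, hk⟩ := hrB
  rw [← map_pow] at hk
  -- `span (ȳ) = (span ỹ).map`
  have hspan : Ideal.span (Set.range fun i => algebraMap S B (yt i)) =
      (Ideal.span (Set.range yt)).map (algebraMap S B) := by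
    rw [Ideal.map_span, ← Set.range_comp]
    rfl
  rw [hspan, Ideal.mem_map_iff_of_surjective _ hsurj] at hk
  obtain ⟨q, hq, hqr⟩ := hk
  have hdiff : r ^ k - q ∈ Ideal.span {g} := hker _ (by rw [map_sub, hqr, sub_self])
  refine ⟨k, ?_⟩
  have : r ^ k = (r ^ k - q) + q := by ring
  rw [this]
  refine Ideal.add_mem _ ?_ ?_
  · refine Ideal.span_mono ?_ hdiff
    intro x hx
    rw [Set.mem_singleton_iff] at hx
    exact ⟨0, by rw [hx]; rfl⟩
  · refine Ideal.span_mono ?_ hq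
    rintro _ ⟨i, rfl⟩
    exact ⟨i.succ, by simp⟩

/-- **SGA 2 XI 3.13 (ii) for hypersurfaces, complete case, on `S/(g^1)`.** [cite:
Grothendieck1968SGA2, Exp. XI Thm. 3.13 (ii)] -/
theorem samuel_hypersurface_complete_thick (S : Type u) [CommRing S] [IsRegularLocalRing S]
    [IsAdicComplete (maximalIdeal S) S] (g : S) (hgm : g ∈ maximalIdeal S) (hg0 : g ≠ 0)
    (hdim : (4 : WithBot ℕ∞) ≤ ringKrullDim (Thick g 1))
    (J : Ideal (Thick g 1)) (hreg : ∃ c ∈ J, c ∈ (Thick g 1)⁰)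
    (hloc : ∀ (Q : Ideal (Thick g 1)) [Q.IsPrime], ¬ Q.IsMaximal →
      (J.map (algebraMap (Thick g 1) (Localization.AtPrime Q))).IsPrincipal)
    (hsat : ∀ b : Thick g 1, (∀ x : Thick g 1, ¬ IsUnit x → x * b ∈ J) → b ∈ J) :
    J.IsPrincipal := by
  classical
  haveI : IsDomain S := isDomain_of_isRegularLocalRing S
  haveI : UniqueFactorizationMonoid S := uniqueFactorizationMonoid_of_isRegularLocalRing S ‹_›
  have hg1m : g ^ 1 ∈ maximalIdeal S := by rw [pow_one]; exact hgm
  have hg10 : g ^ 1 ≠ 0 := by rw [pow_one]; exact hg0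
  have hgS : g ∈ S⁰ := mem_nonZeroDivisors_of_ne_zero hg0
  haveI : Nontrivial (Thick g 1) := (isLocalRing_quotient_span_singleton hg1m).1
  haveI : IsLocalRing (Thick g 1) := (isLocalRing_quotient_span_singleton hg1m).2
  haveI : IsNoetherianRing (Thick g 1) := Ideal.Quotient.isNoetherianRing _
  have hsurj : Function.Surjective (algebraMap S (Thick g 1)) := Ideal.Quotient.mk_surjective
  have hkerB : ∀ x : S, algebraMap S (Thick g 1) x = 0 ↔ x ∈ Ideal.span {g} := by
    intro x
    rw [Ideal.Quotient.algebraMap_eq, Ideal.Quotient.eq_zero_iff_mem]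
    have : Ideal.span ({g ^ 1} : Set S) = Ideal.span {g} := by rw [pow_one]
    rw [this]
  have hmB : (maximalIdeal S).map (algebraMap S (Thick g 1)) = maximalIdeal (Thick g 1) :=
    (maximalIdeal_quotient_eq_map
      (Ideal.span ({g ^ 1} : Set S))).symm
  -- the regular sequence on `(Thick g 1)` (Cohen–Macaulay of dimension `≥ 4`)
  obtain ⟨rsB, hrsBm, hrsB, hrsBlen⟩ := exists_isRegular_quotient_span_singleton S hg1m hg10
  have hlen4 : 4 ≤ rsB.length := by
    have h1 : ((4 : ℕ) : WithBot ℕ∞) ≤ (rsB.length : WithBot ℕ∞) := by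
      rw [hrsBlen]; exact_mod_cast hdim
    exact_mod_cast h1
  -- a non-maximal prime of `(Thick g 1)`
  have hQ : ∃ Q : Ideal (Thick g 1), Q.IsPrime ∧ ¬ Q.IsMaximal := by
    apply exists_isPrime_not_isMaximal
    intro h0
    have h4 : (4 : WithBot ℕ∞) ≤ 0 := hdim.trans h0
    exact absurd h4 (by exact_mod_cast (by norm_num : ¬ ((4 : ℕ) ≤ 0)))
  -- cover data `ȳ, ā` in `(Thick g 1)`, lifted to `S`: `y = (g, ỹ)`, `a = (0, ā)`
  obtain ⟨s, ybar, abar, hyBm, haBJ, hcovB, hradB⟩ := exists_cover_of_forall_isPrincipal_map J hloc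
  set yt : Fin s → S := fun i => Function.surjInv hsurj (ybar i) with hyt
  have hytB : ∀ i, algebraMap S (Thick g 1) (yt i) = ybar i := fun i => Function.surjInv_eq hsurj (ybar i)
  set y : Fin (s + 1) → S := Fin.cons g yt with hydef
  set a : Fin (s + 1) → (Thick g 1) := Fin.cons 0 abar with hadef
  have ha : ∀ i, a i ∈ J := fun i => by
    refine Fin.cases ?_ (fun k => ?_) i
    · exact J.zero_mem
    · exact haBJ k
  have hym : ∀ i, y i ∈ maximalIdeal S := fun i => by
    refine Fin.cases ?_ (fun k => ?_) i
    · exact hgm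
    · change yt k ∈ maximalIdeal S
      rw [mem_maximalIdeal]
      intro hu
      have : IsUnit (algebraMap S (Thick g 1) (yt k)) := hu.map _
      rw [hytB] at this
      exact (mem_maximalIdeal _).mp (hyBm k) this
  have hgB : algebraMap S (Thick g 1) g = 0 := (hkerB g).mpr (Ideal.mem_span_singleton_self g)
  have hcov : ∀ (i : Fin (s + 1)) (b : (Thick g 1)), b ∈ J → ∃ c : (Thick g 1), y i • b = c * a i := by
    intro i b hb
    refine Fin.cases ?_ (fun k => ?_) i
    · refine ⟨0, ?_⟩
      change g • b = 0 * 0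
      rw [Algebra.smul_def, hgB, zero_mul, zero_mul]
    · obtain ⟨c, hc⟩ := Ideal.mem_span_singleton'.mp (hcovB k b hb)
      refine ⟨c, ?_⟩
      change yt k • b = c * abar k
      rw [Algebra.smul_def, hytB, hc]
  -- `√(y) ⊇ 𝔪_S` and `√(ȳ) = 𝔪_B`
  have hradB' : (Ideal.span (Set.range fun i => algebraMap S (Thick g 1) (yt i))).radical = maximalIdeal (Thick g 1) := by
    have : (fun i => algebraMap S (Thick g 1) (yt i)) = ybar := funext hytB
    rw [this, hradB]
  have hradS : maximalIdeal S ≤ (Ideal.span (Set.range y)).radical :=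
    maximalIdeal_le_radical_span_cons yt hsurj (fun x hx => (hkerB x).mp hx) hmB hradB'
  have hradBy : (Ideal.span (Set.range fun i => algebraMap S (Thick g 1) (y i))).radical = maximalIdeal (Thick g 1) := by
    apply le_antisymm
    · rw [Ideal.IsPrime.radical_le_iff (maximalIdeal.isMaximal (Thick g 1)).isPrime, Ideal.span_le]
      rintro _ ⟨i, rfl⟩
      rw [SetLike.mem_coe, ← hmB]
      exact Ideal.mem_map_of_mem _ (hym i)
    · rw [← hradB']
      refine Ideal.radical_mono (Ideal.span_mono ?_)
      rintro _ ⟨i, rfl⟩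
      exact ⟨i.succ, by simp [hydef]⟩
  -- the `S`-regular sequence on `(Thick g 1)`
  set rsS : List S := rsB.map (Function.surjInv hsurj) with hrsS
  have hrsSmap : rsS.map (Ideal.Quotient.mk (Ideal.span ({g ^ 1} : Set S))) = rsB := by
    rw [hrsS, List.map_map]
    conv_rhs => rw [← List.map_id rsB]
    refine List.map_congr_left fun r _ => ?_
    exact Function.surjInv_eq hsurj r
  have hrsSreg : RingTheory.Sequence.IsRegular (Thick g 1) rsS :=
    isRegular_quotient_of_map (Ideal.span ({g ^ 1} : Set S)) rsS (by rw [hrsSmap]; exact hrsB)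
  have hrsSrad : ∀ r ∈ rsS, r ∈ (Ideal.span (Set.range y)).radical := by
    intro r hr
    rw [hrsS, List.mem_map] at hr
    obtain ⟨r', hr', rfl⟩ := hr
    apply hradS
    rw [mem_maximalIdeal]
    intro hu
    have : IsUnit (algebraMap S (Thick g 1) (Function.surjInv hsurj r')) := hu.map _
    rw [Function.surjInv_eq hsurj r'] at this
    exact (mem_maximalIdeal _).mp (hrsBm r' hr') this
  have hlenS : rsS.length = rsB.length := by rw [hrsS, List.length_map]
  obtain ⟨hB0, hB1, hB2⟩ := cech_exact_of_isRegular rsS (Thick g 1) hrsSreg hrsSrad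
  have hB0' := hB0 (by omega)
  have hB1' := hB1 (by omega)
  have hH3 : ∀ z : CechObj y (Thick g 1) 2, dC 2 z = 0 → ∃ v : CechObj y (Thick g 1) 1, dC 1 v = z :=
    hB2 1 (by omega)
  -- depth of `J`
  obtain ⟨hJ0, hJ1⟩ := cech_exact_ideal_of_saturated y hradBy hB0' hB1' J hsat
  -- the regular element and the non-zero-divisor condition for `Φ`
  obtain ⟨c₀, hc₀J, hc₀⟩ := hreg
  have hc₀' : ∀ b : (Thick g 1), b * c₀ = 0 → b = 0 := fun b hb =>
    (mul_right_mem_nonZeroDivisors_eq_zero_iff hc₀).mp hb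
  have hreg' : ∀ {n : ℕ} (t : Fin (n + 1) → Fin (s + 1)) (z : CechLoc y (Thick g 1) t),
      z * LocalizedModule.mk (a (t 0)) 1 = 0 → z = 0 := fun t z hz =>
    mul_mk_eq_zero_imp_of_cover J a hcov c₀ hc₀J hc₀' t z hz
  -- the unit cocycle `u₁ = ā_j/ā_i` and the formal family
  set u₁ := coverCocycle J a ha hcov with hu₁
  have hu : ∀ t : Fin 2 → Fin (s + 1),
      u₁ t * LocalizedModule.mk (a (t 0)) 1 = LocalizedModule.mk (a (t 1)) 1 :=
    coverCocycle_spec J a ha hcov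
  have h1 : IsMulCocycle u₁ ∧ ∀ t, IsUnit (u₁ t) :=
    ⟨isMulCocycle_coverCocycle J a ha hcov hreg', fun t => isUnit_coverCocycle J a ha hcov hreg' t⟩
  set uF := uFam g y hgS hH3 u₁ h1 with huF
  have hc : IsCompatible uF := isCompatible_uFam g y hgS hH3 u₁ h1
  have hcoc : ∀ L, IsMulCocycle (uF L) := isMulCocycle_uFam g y hgS hH3 u₁ h1
  -- `Φ₀` bijective, `Φ₁` injective
  have hsurj0 := twistToIdeal_surjective J a ha hcov 0
  have hinj0 := twistToIdeal_injective J a ha hreg' 0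
  have hinj1 := twistToIdeal_injective J a ha hreg' 1
  -- finiteness: `E = TH2 u₁` is Noetherian over `S`
  haveI hfinB : Module.Finite (Thick g 1) (H2 (y := yB (Thick g 1) y) (M := ↥J)) :=
    Module.finite_H2_ideal (y := yB (Thick g 1) y) J ⟨c₀, hc₀J, hc₀⟩ hloc hsat
      (fun r hr => by
        show r ∈ (Ideal.span (Set.range fun i => algebraMap S (Thick g 1) (y i))).radical
        rw [hradBy]; exact hr)
      rsB hrsB (by omega) hrsBm
  haveI : Module.Finite S (Thick g 1) := Module.Finite.of_surjective (Algebra.linearMap S (Thick g 1)) hsurj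
  haveI : IsNoetherian S ((Z1 (y := yB (Thick g 1) y) (M := ↥J)).restrictScalars S ⧸
      ((B1 (y := yB (Thick g 1) y) (M := ↥J)).restrictScalars S)) := by
    haveI : Module.Finite S (H2 (y := yB (Thick g 1) y) (M := ↥J)) :=
      Module.Finite.trans (Thick g 1) _
    haveI : IsNoetherian S (H2 (y := yB (Thick g 1) y) (M := ↥J)) := inferInstance
    exact isNoetherian_of_linearEquiv
      (Submodule.Quotient.restrictScalarsEquiv S (B1 (y := yB (Thick g 1) y) (M := ↥J))).symm
  haveI : IsNoetherian S (H2 (y := y) (M := ↥J)) := isNoetherian_H2_of_baseChange (Thick g 1) y ↥J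
  haveI hE : IsNoetherian S (TH2 u₁) := isNoetherian_TH2_of_cover J a ha u₁ hu hcov c₀ hc₀J hc₀'
  haveI : IsNoetherian S (TH2 (uF 1)) := hE
  -- uniform Mittag-Leffler
  obtain ⟨n, hstab⟩ := secIm_stable hc hcoc hgS
  -- `𝔪^c` kills `E`
  have htor : ∀ (e : TH2 u₁) (j : Fin (s + 1)), ∃ K : ℕ, y j ^ K • e = 0 := by
    intro e j
    obtain ⟨K, hK⟩ := exists_pow_smul_H2_eq_zero (twistToIdealH2 J a ha u₁ hu e) j
    refine ⟨K, twistToIdealH2_injective J a ha u₁ hu hsurj0 hinj1 ?_⟩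
    rw [LinearMap.map_smul, hK, map_zero]
  haveI : Module.Finite S (TH2 u₁) := Module.IsNoetherian.finite S _
  obtain ⟨c, hc𝔪⟩ := exists_pow_ideal_smul_eq_zero htor (maximalIdeal S) hradS
  -- the comparison map
  set Ψ := compIdeal J a ha n hu hJ0 hJ1 hc with hΨ
  set θ : Nlim uF n →ₗ[S] (Thick g 1) := (J.subtype.restrictScalars S) ∘ₗ Ψ with hθ
  have hθapply : ∀ x, θ x = (Ψ x : (Thick g 1)) := fun x => rfl
  -- conclude by the algebraisation endgame
  have hsat' : ∀ b : (Thick g 1), (∀ x ∈ maximalIdeal (Thick g 1), x * b ∈ J) → b ∈ J := fun b hb =>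
    hsat b fun x hx => hb x ((mem_maximalIdeal x).mpr hx)
  refine isPrincipal_of_comparison g hsurj θ J (fun x => (Ψ x).2) hkerB hmB hgm (c * (n + 1))
    ?_ ?_ ?_ ?_ ?_ ⟨c₀, hc₀J, hc₀⟩ hloc hsat' hrsB hrsBm (by omega) hQ
  · -- the cokernel bound
    intro r hr j hj
    rw [pow_mul] at hr
    obtain ⟨x, hx⟩ := exists_compIdeal_eq_smul J a ha n hu hJ0 hJ1 hc hcoc hgS hstab hsurj0 hinj1
      (maximalIdeal S ^ c) (fun e r hr => hc𝔪 e r hr) hr ⟨j, hj⟩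
    exact ⟨x, by rw [hθapply, hx, Submodule.coe_smul_of_tower, Algebra.smul_def]⟩
  · -- the kernel
    intro x hx
    have : Ψ x = 0 := Subtype.ext (by rw [← hθapply, hx]; rfl)
    exact exists_eq_smul_of_compIdeal_eq_zero J a ha n hu hJ0 hJ1 hc hgS hinj0 x this
  · exact fun x hx => Nlim_subtype_separated n x hx
  · exact fun r hr x hx => Nlim_subtype_torsionFree n hg0 r hr x hx
  · exact fun x k hk => exists_eq_smul_of_pow_smul_mem n hc hgS (maximalIdeal S) hym x k hk

/-- **SGA 2 XI 3.13 (ii) for hypersurfaces, complete case** (`hC` of the reduction chain): for a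
complete regular local ring `S`, `0 ≠ g ∈ 𝔪`, `dim S/(g) ≥ 4`, every ideal `J ⊆ S/(g)`
containing a non-zero-divisor, principal at the non-maximal primes and `𝔪`-saturated is
principal. [cite: Grothendieck1968SGA2, Exp. XI Thm. 3.13 (ii)] -/
theorem samuel_hypersurface_complete (S : Type u) [CommRing S] [IsRegularLocalRing S]
    [IsAdicComplete (maximalIdeal S) S] (g : S) (hgm : g ∈ maximalIdeal S) (hg0 : g ≠ 0)
    (hdim : (4 : WithBot ℕ∞) ≤ ringKrullDim (S ⧸ Ideal.span {g}))
    (J : Ideal (S ⧸ Ideal.span {g})) (hreg : ∃ c ∈ J, c ∈ (S ⧸ Ideal.span {g})⁰)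
    (hloc : ∀ (Q : Ideal (S ⧸ Ideal.span {g})) [Q.IsPrime], ¬ Q.IsMaximal →
      (J.map (algebraMap (S ⧸ Ideal.span {g}) (Localization.AtPrime Q))).IsPrincipal)
    (hsat : ∀ a : S ⧸ Ideal.span {g}, (∀ x : S ⧸ Ideal.span {g}, ¬ IsUnit x → x * a ∈ J) → a ∈ J) :
    J.IsPrincipal := by
  have hspan : Ideal.span ({g} : Set S) = Ideal.span {g ^ 1} := by rw [pow_one]
  let e : (S ⧸ Ideal.span ({g} : Set S)) ≃+* (S ⧸ Ideal.span ({g ^ 1} : Set S)) :=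
    Ideal.quotEquivOfEq hspan
  have hdim' : (4 : WithBot ℕ∞) ≤ ringKrullDim (S ⧸ Ideal.span ({g ^ 1} : Set S)) := by
    rw [← ringKrullDim_eq_of_ringEquiv e]
    exact hdim
  have key := samuel_hypersurface_complete_thick S g hgm hg0 hdim'
    (J.map (e : (S ⧸ Ideal.span ({g} : Set S)) →+* (S ⧸ Ideal.span ({g ^ 1} : Set S))))
    (exists_mem_nonZeroDivisors_map_ringEquiv e J hreg)
    (isPrincipal_map_localization_map_ringEquiv e J hloc) (saturated_map_ringEquiv e J hsat)
  exact isPrincipal_of_map_ringEquiv e J key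

/-- **Grothendieck's theorem (Samuel's conjecture) for hypersurfaces** — SGA 2 XI Cor. 3.14:
if `R` is a regular local ring and `f ∈ 𝔪_R`, and `(R/(f))_𝔭` is factorial for every prime
`𝔭` of height `≤ 3`, then `R/(f)` is factorial. Assembled from the reduction to the complete
case (`Grothendieck1968_samuelConjecture_hypersurface_of_complete`: XI 3.10, 3.7, outer
induction) and the complete case `samuel_hypersurface_complete` (XI 3.13 (ii): Čech local
cohomology of the formal line bundle, uniform Mittag-Leffler, algebraisation).
[cite: Grothendieck1968SGA2, Exp. XI Cor. 3.14; CallLyubeznik1994] -/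
theorem Grothendieck1968_samuelConjecture_hypersurface_holds :
    Grothendieck1968_samuelConjecture_hypersurface.{u} :=
  Grothendieck1968_samuelConjecture_hypersurface_of_complete
    fun S _ _ _ g hg hg0 h4 J hJ hloc hsat =>
      samuel_hypersurface_complete S g hg hg0 h4 J hJ hloc hsat

end MainKernel

end Literature.RingTheory.RegularLocalRing

end
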